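import Summits.KontsevichZagierPeriods.Zeta5Search.DualSeriesDenominators
import Summits.KontsevichZagierPeriods.Zeta5Search.DualSeriesNineCoefficients
import HarnessLib

/-!
# ζ(5) search — PROVED denominators for the dual series `F̃₉(b)` (cell `pub-zeta5`, PROVER 3; `k = 9` port of the
# typer's `DualSeriesDenominators.lean`)

HONEST FRAMING: systematic search; no irrationality claim unless certified.

OUR theorem (Summit side) about `F̃₉(b)` (Brown–Zudilin arXiv:2210.03391 (34), `k = 9`; Zudilin JTNB 16 (2004) §8
with `q = 9`, `r = 1`) in the cell's partial-fraction language (`DualSeriesNine.numPoly`: summand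
`numPoly_b(X)/(X)_{b₀+1}^8`; `DualSeriesNine.{IsPFData9, coeff7, coeff5, coeff3, coeff0}` of
`DualSeriesNineCoefficients.lean`). Write `n = b₀`, `f_j = (X)_{b_j}`, `s_j = (X+b₀−b_j+1)_{b_j}` (`j = 1..9`).
For the EIGHT CONSECUTIVE pairs `(j, j+1)`, `j = 1..8`, `f_j s_{j+1}/(X)_{n+1} = 1/(X+b_j)_{n+1−b_j−b_{j+1}}` is a
reciprocal brick on a sub-block with integer residues after multiplication by `(n−b_j−b_{j+1})!`
(`PFSteps.subBlock_eq_brickEval`); the remaining factors `(2X+b₀)`, `f₉`, `s₁` are products of integer linear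
factors (`PFSteps.linSteps`). Hence, with

  `N₉(b) = ∏_{j=1}^{8} (b₀ − b_j − b_{j+1})!`   (`normaliser9`),

* `exists_int_data9` — for `d` any common multiple of `1..b₀`: THE partial-fraction data `c` of `R_b` satisfy
  `d^{7−o} · N₉(b) · c_{o,p} ∈ ℤ` (`o < 8`, `p ≤ b₀`);
* `coeff7_den`, `coeff5_den`, `coeff3_den`, `coeff0_den` — **`d_{b₀}·N₉·coeff7 ∈ ℤ`, `d_{b₀}³·N₉·coeff5 ∈ ℤ`,
  `d_{b₀}⁵·N₉·coeff3 ∈ ℤ`, `d_{b₀}⁸·N₉·coeff0 ∈ ℤ`** (`d_{b₀} = Nat.lcmUpto b₀`), on the box `InBox b` with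
  `Σ_j b_j ≤ 4b₀+2` and the eight pair conditions `b_j + b_{j+1} ≤ b₀`.

This is the generic (Rivoal-brick) strength, matching Zudilin 2004 (9.3)'s exponent pattern `1, 3, 5` for the
`ζ(7), ζ(5), ζ(3)` coefficients up to the choice of the lcm index (here `b₀` throughout) — the `q = 9` row D2 of
`families/denom/FAMILY.md` §6; fam-vwp's rays (e.g. `(3;1⁹)`, `(16;3,3,4,4,5,5,6,6,7)`, `(20;5,6,6,7,7,8,8,9,9)`) satisfy the
pair conditions. The consecutive pairing is A valid choice, not the sharpest for every ray. 0 sorry.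
-/

noncomputable section

open Finset Polynomial
open Literature.NumberTheory.Transcendental
open Literature.NumberTheory.Transcendental.BallRivoal

namespace Summit.KontsevichZagierPeriods.Zeta5Search

namespace DualSeriesNineDenominators

open DualSeriesNine PFSteps
open DualSeriesDenominators (poch_add poch_ne_zero_of_add linProd_range linProd_append bn fF sF ell
  poch_block_ne_zero natCast_dvd_lcmUpto)

/-! ### The core algebraic identity (atoms as variables), eight pairs -/

/-- Regrouping `N·(ℓ·∏_j f_j s_j)/P⁸` into `(ℓ f₉ s₁)·∏_{pairs} N_s/m_s` given the eight factorisations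
`P = f_j m_s s_{j+1}` (`j = 1..8`); the `m_s` need not be assumed non-zero (it follows, and `ring` treats inverses
formally). -/
theorem regroup9 {K : Type*} [Field K]
    (ℓ f1 f2 f3 f4 f5 f6 f7 f8 f9 s1 s2 s3 s4 s5 s6 s7 s8 s9 m1 m2 m3 m4 m5 m6 m7 m8
      N1 N2 N3 N4 N5 N6 N7 N8 P : K)
    (h1 : P = f1 * m1 * s2) (h2 : P = f2 * m2 * s3) (h3 : P = f3 * m3 * s4) (h4 : P = f4 * m4 * s5)
    (h5 : P = f5 * m5 * s6) (h6 : P = f6 * m6 * s7) (h7 : P = f7 * m7 * s8) (h8 : P = f8 * m8 * s9)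
    (hP : P ≠ 0) :
    (N1 * N2 * N3 * N4 * N5 * N6 * N7 * N8) *
        ((ℓ * ((f1 * s1) * (f2 * s2) * (f3 * s3) * (f4 * s4) * (f5 * s5) * (f6 * s6) * (f7 * s7) * (f8 * s8)
          * (f9 * s9))) / P ^ 8)
      = (ℓ * f9 * s1) * ((N1 / m1) * (N2 / m2) * (N3 / m3) * (N4 / m4) * (N5 / m5) * (N6 / m6) * (N7 / m7)
          * (N8 / m8)) := by
  have nz : ∀ {f m s' : K}, P = f * m * s' → f ≠ 0 ∧ s' ≠ 0 := by
    intro f m s' h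
    have h' : f * m * s' ≠ 0 := h ▸ hP
    exact ⟨(mul_ne_zero_iff.1 (mul_ne_zero_iff.1 h').1).1, (mul_ne_zero_iff.1 h').2⟩
  obtain ⟨hf1, hs2⟩ := nz h1
  obtain ⟨hf2, hs3⟩ := nz h2
  obtain ⟨hf3, hs4⟩ := nz h3
  obtain ⟨hf4, hs5⟩ := nz h4
  obtain ⟨hf5, hs6⟩ := nz h5
  obtain ⟨hf6, hs7⟩ := nz h6
  obtain ⟨hf7, hs8⟩ := nz h7
  obtain ⟨hf8, hs9⟩ := nz h8
  have hP8 : P ^ 8 = (m1 * m2 * m3 * m4 * m5 * m6 * m7 * m8) *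
      ((f1 * f2 * f3 * f4 * f5 * f6 * f7 * f8) * (s2 * s3 * s4 * s5 * s6 * s7 * s8 * s9)) := by
    have e : P ^ 8 = (f1 * m1 * s2) * (f2 * m2 * s3) * (f3 * m3 * s4) * (f4 * m4 * s5) * (f5 * m5 * s6)
        * (f6 * m6 * s7) * (f7 * m7 * s8) * (f8 * m8 * s9) := by
      rw [← h1, ← h2, ← h3, ← h4, ← h5, ← h6, ← h7, ← h8]; ring
    rw [e]; ring
  have hA : (f1 * f2 * f3 * f4 * f5 * f6 * f7 * f8) * (s2 * s3 * s4 * s5 * s6 * s7 * s8 * s9) ≠ 0 := by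
    simp [hf1, hf2, hf3, hf4, hf5, hf6, hf7, hf8, hs2, hs3, hs4, hs5, hs6, hs7, hs8, hs9]
  have hnum : ℓ * ((f1 * s1) * (f2 * s2) * (f3 * s3) * (f4 * s4) * (f5 * s5) * (f6 * s6) * (f7 * s7) * (f8 * s8)
      * (f9 * s9)) = (ℓ * f9 * s1) * ((f1 * f2 * f3 * f4 * f5 * f6 * f7 * f8) *
        (s2 * s3 * s4 * s5 * s6 * s7 * s8 * s9)) := by ring
  rw [hnum, hP8, mul_div_mul_right _ _ hA]
  ring

/-! ### The objects for `F̃₉(b)` -/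

/-- First index of the `s`-th pair (consecutive pairing): `s + 1`, i.e. pairs `(1,2),(2,3),…,(8,9)`. -/
def pfst9 (s : ℕ) : ℕ := s + 1

/-- Second index of the `s`-th pair: `s + 2`. -/
def psnd9 (s : ℕ) : ℕ := s + 2

/-- Length `L_s = b₀ + 1 − b_{s+1} − b_{s+2}` of the middle block of the `s`-th pair. -/
def blockLen9 (b : ℕ → ℤ) (s : ℕ) : ℕ := bn b 0 + 1 - bn b (pfst9 s) - bn b (psnd9 s)

/-- **The normaliser** `N₉(b) = ∏_{s<8} (b₀ − b_{s+1} − b_{s+2})!`. -/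
def normaliser9 (b : ℕ → ℤ) : ℕ := ∏ s ∈ range 8, (blockLen9 b s - 1).factorial

/-- The residues of the eight sub-block bricks. -/
def brickA9 (b : ℕ → ℤ) : ℕ → ℕ → ℤ := fun s => subRes (bn b (pfst9 s)) (blockLen9 b s)

/-- The integer linear factors `2t + (b₀+2)`, `t + 1 + i` (`i < b₉`), `t + (b₀ − b₁ + 2) + i` (`i < b₁`). -/
def linFactors9 (b : ℕ → ℤ) : List (ℤ × ℤ) :=
  ((2 : ℤ), (bn b 0 : ℤ) + 2) ::
    (((List.range (bn b 9)).map fun i : ℕ => ((1 : ℤ), (1 : ℤ) + (i : ℤ)))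
      ++ ((List.range (bn b 1)).map fun i : ℕ => ((1 : ℤ), ((bn b 0 : ℤ) - bn b 1 + 2) + (i : ℤ))))

/-- Middle block `m_s = (t+1+b_{s+1})_{L_s}` of the `s`-th pair. -/
def mF9 (b : ℕ → ℤ) (t : ℚ) (s : ℕ) : ℚ := poch (t + 1 + bn b (pfst9 s)) (blockLen9 b s)

/-! ### The pieces of the product identity -/

/-- On the box, `(b_j : ℚ) = bn b j` (`j ≤ 9`). -/
theorem cast_bn9 {b : ℕ → ℤ} (hb : InBox b) (j : ℕ) (hj : j ≤ 9) : ((b j : ℤ) : ℚ) = (bn b j : ℚ) := by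
  have h0 : 0 ≤ b j := by
    rcases Nat.eq_zero_or_pos j with rfl | hpos
    · exact hb.1
    · obtain ⟨i, rfl⟩ : ∃ i, j = i + 1 := ⟨j - 1, by omega⟩
      exact (hb.2 i (mem_range.2 (by omega))).1
  rw [bn, show ((b j : ℤ) : ℚ) = (((b j).toNat : ℤ) : ℚ) by rw [Int.toNat_of_nonneg h0]]
  norm_cast

/-- (E1) The numerator: `numPoly_b(t+1) = ℓ · ∏_{j=1}^{9} f_j s_j`. -/
theorem numerator_eq9 {b : ℕ → ℤ} (hb : InBox b) (t : ℚ) :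
    ((numPoly b).comp (X + C 1)).eval t
      = ell b t * ((fF b t 1 * sF b t 1) * (fF b t 2 * sF b t 2) * (fF b t 3 * sF b t 3) * (fF b t 4 * sF b t 4)
          * (fF b t 5 * sF b t 5) * (fF b t 6 * sF b t 6) * (fF b t 7 * sF b t 7) * (fF b t 8 * sF b t 8)
          * (fF b t 9 * sF b t 9)) := by
  rw [eval_comp, eval_add, eval_X, eval_C, eval_numPoly]
  have hj : ∀ j ∈ range 9, poch (t + 1) (b (j + 1)).toNat *
      poch (t + 1 + ((b 0 - b (j + 1) + 1 : ℤ) : ℚ)) (b (j + 1)).toNat = fF b t (j + 1) * sF b t (j + 1) := by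
    intro j hjm
    have hj9 : j + 1 ≤ 9 := by have := mem_range.1 hjm; omega
    rw [DualSeriesDenominators.fF, DualSeriesDenominators.sF, bn]
    congr 2
    push_cast
    rw [cast_bn9 hb 0 (by norm_num), cast_bn9 hb (j + 1) hj9, bn, bn]
  rw [prod_congr rfl hj, cast_bn9 hb 0 (by norm_num), DualSeriesDenominators.ell]
  simp only [prod_range_succ, prod_range_zero, one_mul]
  ring

/-- (E2) The normaliser as a product of eight factorials (cast). -/
theorem cast_normaliser9 (b : ℕ → ℤ) :
    (normaliser9 b : ℚ) = ((blockLen9 b 0 - 1).factorial : ℚ) * ((blockLen9 b 1 - 1).factorial : ℚ)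
      * ((blockLen9 b 2 - 1).factorial : ℚ) * ((blockLen9 b 3 - 1).factorial : ℚ)
      * ((blockLen9 b 4 - 1).factorial : ℚ) * ((blockLen9 b 5 - 1).factorial : ℚ)
      * ((blockLen9 b 6 - 1).factorial : ℚ) * ((blockLen9 b 7 - 1).factorial : ℚ) := by
  rw [normaliser9]
  push_cast
  simp only [prod_range_succ, prod_range_zero, one_mul]

/-- (E3) The `s`-th factorisation of the block: `(t+1)_{n+1} = f_{s+1} · m_s · s_{s+2}`. -/
theorem block_eq_pair9 {b : ℕ → ℤ} (hP : ∀ s, s < 8 → bn b (pfst9 s) + bn b (psnd9 s) ≤ bn b 0) (t : ℚ) (s : ℕ)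
    (hs : s < 8) :
    poch (t + 1) (bn b 0 + 1) = fF b t (pfst9 s) * mF9 b t s * sF b t (psnd9 s) := by
  have hle := hP s hs
  have hsplit : bn b 0 + 1 = bn b (pfst9 s) + (blockLen9 b s + bn b (psnd9 s)) := by
    unfold blockLen9; omega
  have this : ((bn b (pfst9 s) : ℕ) : ℚ) + (blockLen9 b s : ℕ) = (bn b 0 : ℚ) - bn b (psnd9 s) + 1 := by
    have e : bn b (pfst9 s) + blockLen9 b s = bn b 0 + 1 - bn b (psnd9 s) := by unfold blockLen9; omega
    have e' : ((bn b (pfst9 s) + blockLen9 b s : ℕ) : ℚ) = ((bn b 0 + 1 - bn b (psnd9 s) : ℕ) : ℚ) := by rw [e]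
    push_cast [Nat.cast_sub (show bn b (psnd9 s) ≤ bn b 0 + 1 by omega)] at e'
    linarith
  have hX : t + 1 + ((bn b (pfst9 s) : ℕ) : ℚ) + ((blockLen9 b s : ℕ) : ℚ)
      = t + 1 + (((bn b 0 : ℕ) : ℚ) - ((bn b (psnd9 s) : ℕ) : ℚ) + 1) := by linarith
  rw [hsplit, poch_add, poch_add, DualSeriesDenominators.fF, mF9, DualSeriesDenominators.sF, hX, mul_assoc]

/-- (E4) The `s`-th brick is the sub-block brick: `brickEval n (brickA9 b s) t = (L_s−1)!/m_s`. -/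
theorem brick_eq9 {b : ℕ → ℤ} (hP : ∀ s, s < 8 → bn b (pfst9 s) + bn b (psnd9 s) ≤ bn b 0) (t : ℚ)
    (ht : ∀ p, p ≤ bn b 0 → t + p + 1 ≠ 0) (s : ℕ) (hs : s < 8) :
    brickEval (bn b 0) (brickA9 b s) t = (((blockLen9 b s - 1).factorial : ℕ) : ℚ) / mF9 b t s := by
  have hle := hP s hs
  rw [brickA9, mF9, ← subBlock_eq_brickEval (bn b 0) (bn b (pfst9 s)) (blockLen9 b s)
    (by unfold blockLen9; omega) (by unfold blockLen9; omega) t ht]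
  congr 2
  ring

/-- (E5) The linear factors multiply to `ℓ · f₉ · s₁`. -/
theorem linProd_linFactors9 (b : ℕ → ℤ) (t : ℚ) :
    linProd (linFactors9 b) t = ell b t * fF b t 9 * sF b t 1 := by
  rw [linFactors9, linProd, List.map_cons, List.prod_cons, ← linProd, linProd_append, linProd_range,
    linProd_range, DualSeriesDenominators.ell, DualSeriesDenominators.fF, DualSeriesDenominators.sF]
  push_cast
  have e : t + (((bn b 0 : ℕ) : ℚ) - (bn b 1 : ℕ) + 2) = t + 1 + ((bn b 0 : ℚ) - bn b 1 + 1) := by ring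
  rw [e]
  ring

/-- **The product identity**: `N₉(b) · numPoly_b(t+1)/(t+1)_{n+1}^8 = (ℓ f₉ s₁) · ∏_{s<8} brick_s(t)`. -/
theorem normaliser_mul_eq9 {b : ℕ → ℤ} (hb : InBox b) (hP : ∀ s, s < 8 → bn b (pfst9 s) + bn b (psnd9 s) ≤ bn b 0)
    (t : ℚ) (ht : ∀ p, p ≤ bn b 0 → t + p + 1 ≠ 0) :
    (normaliser9 b : ℚ) * (((numPoly b).comp (X + C 1)).eval t / poch (t + 1) (bn b 0 + 1) ^ 8)
      = linProd (linFactors9 b) t * ∏ s ∈ range 8, brickEval (bn b 0) (brickA9 b s) t := by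
  have hPne := poch_block_ne_zero (bn b 0) t ht
  rw [numerator_eq9 hb, cast_normaliser9, linProd_linFactors9]
  simp only [prod_range_succ, prod_range_zero, one_mul]
  rw [brick_eq9 hP t ht 0 (by norm_num), brick_eq9 hP t ht 1 (by norm_num), brick_eq9 hP t ht 2 (by norm_num),
    brick_eq9 hP t ht 3 (by norm_num), brick_eq9 hP t ht 4 (by norm_num), brick_eq9 hP t ht 5 (by norm_num),
    brick_eq9 hP t ht 6 (by norm_num), brick_eq9 hP t ht 7 (by norm_num)]
  exact regroup9 (ell b t) (fF b t 1) (fF b t 2) (fF b t 3) (fF b t 4) (fF b t 5) (fF b t 6) (fF b t 7)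
    (fF b t 8) (fF b t 9)
    (sF b t 1) (sF b t 2) (sF b t 3) (sF b t 4) (sF b t 5) (sF b t 6) (sF b t 7) (sF b t 8) (sF b t 9)
    (mF9 b t 0) (mF9 b t 1) (mF9 b t 2) (mF9 b t 3) (mF9 b t 4) (mF9 b t 5) (mF9 b t 6) (mF9 b t 7)
    _ _ _ _ _ _ _ _ _
    (block_eq_pair9 hP t 0 (by norm_num)) (block_eq_pair9 hP t 1 (by norm_num))
    (block_eq_pair9 hP t 2 (by norm_num)) (block_eq_pair9 hP t 3 (by norm_num))
    (block_eq_pair9 hP t 4 (by norm_num)) (block_eq_pair9 hP t 5 (by norm_num))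
    (block_eq_pair9 hP t 6 (by norm_num)) (block_eq_pair9 hP t 7 (by norm_num))
    hPne

/-! ### Integrality of THE partial-fraction data -/

/-- **`d^{7−o}·N₉(b)·c_{o,p} ∈ ℤ` for THE partial-fraction data of `R_b`** (`o < 8`, `p ≤ b₀`; `d` any common
multiple of `1, …, b₀`), on the box with `Σ_j b_j ≤ 4b₀ + 2` and the eight pair conditions. -/
theorem exists_int_data9 {b : ℕ → ℤ} (hb : InBox b)
    (hP : ∀ s, s < 8 → bn b (pfst9 s) + bn b (psnd9 s) ≤ bn b 0)
    (hsum : ∑ j ∈ range 9, b (j + 1) ≤ 4 * b 0 + 2)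
    (d : ℕ) (hdiv : ∀ k : ℕ, 1 ≤ k → k ≤ bn b 0 → (k : ℤ) ∣ d) :
    ∃ c : ℕ → ℕ → ℚ, IsPFData9 b c ∧
      ∀ o p, o < 8 → p ≤ bn b 0 → ∃ z : ℤ, (d : ℚ) ^ (7 - o) * ((normaliser9 b : ℚ) * c o p) = z := by
  obtain ⟨c₀, hc₀, hint₀, -⟩ := exists_pf_prod (bn b 0) d hdiv (brickA9 b) 8 (by norm_num)
  have hc₁s : ∀ o p, 8 ≤ o → trunc 8 c₀ o p = 0 := fun o p ho => trunc_of_le ho p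
  have hint₂ : IsInt 8 d (linSteps (linFactors9 b) (trunc 8 c₀)) :=
    isInt_linSteps hc₁s (isInt_trunc hint₀) _
  obtain ⟨c, hc⟩ := exists_isPFData9 b hb hsum
  refine ⟨c, hc, ?_⟩
  have hnat : ∀ k : ℕ, 0 ≤ k →
      pfEval (bn b 0) 8 (fun o p => linSteps (linFactors9 b) (trunc 8 c₀) o p - (normaliser9 b : ℚ) * c o p) k
        + (polyPart (bn b 0) (linFactors9 b) (trunc 8 c₀)).eval (k : ℚ) = 0 := by
    intro k _
    have hk : ∀ p, p ≤ bn b 0 → (k : ℚ) + p + 1 ≠ 0 := fun p _ => by positivity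
    have h1 := pfEval_linSteps (bn b 0) 8 hc₁s (k : ℚ) hk (linFactors9 b)
    have h2 : pfEval (bn b 0) 8 (trunc 8 c₀) k = ∏ s ∈ range 8, brickEval (bn b 0) (brickA9 b s) k := by
      rw [pfEval_trunc]; exact hc₀ k hk
    have h3 := normaliser_mul_eq9 hb hP (k : ℚ) hk
    have h4 : pfEval (bn b 0) 8 c k
        = ((numPoly b).comp (X + C 1)).eval (k : ℚ) / poch ((k : ℚ) + 1) (bn b 0 + 1) ^ 8 := hc (k : ℚ) hk
    rw [pfEval_sub', pfEval_const_mul, h4]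
    rw [h2, ← h3] at h1
    linear_combination h1
  obtain ⟨-, hzero⟩ := pf_unique_poly (bn b 0) 8 _ _ 0 hnat
  intro o p ho hp
  obtain ⟨z, hz⟩ := hint₂ o p
  refine ⟨z, ?_⟩
  have e : (normaliser9 b : ℚ) * c o p = linSteps (linFactors9 b) (trunc 8 c₀) o p := by
    have := hzero o p ho hp
    linarith
  rw [e, ← hz, show (8 : ℕ) - 1 - o = 7 - o by omega]

/-! ### Denominators of `coeff7`, `coeff5`, `coeff3`, `coeff0` -/

/-- Denominator of a single-order coefficient sum: `d^{7−o}·N₉·Σ_p c_{o,p} ∈ ℤ` in the form `d^e·N₉·(Σ) ∈ ℤ`. -/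
theorem sum_order_den {b : ℕ → ℤ} (hb : InBox b)
    (hP : ∀ s, s < 8 → bn b (pfst9 s) + bn b (psnd9 s) ≤ bn b 0)
    (hsum : ∑ j ∈ range 9, b (j + 1) ≤ 4 * b 0 + 2) (o : ℕ) (ho : o < 8) :
    ∃ c : ℕ → ℕ → ℚ, IsPFData9 b c ∧ ∃ z : ℤ,
      ((Nat.lcmUpto (bn b 0) : ℕ) : ℚ) ^ (7 - o) * (normaliser9 b : ℚ) * ∑ p ∈ range (bn b 0 + 1), c o p = z := by
  obtain ⟨c, hc, hint⟩ := exists_int_data9 hb hP hsum (Nat.lcmUpto (bn b 0))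
    (fun k h1 h2 => natCast_dvd_lcmUpto h1 h2)
  have hterm : ∀ p ∈ range (bn b 0 + 1), ∃ z : ℤ,
      ((Nat.lcmUpto (bn b 0) : ℕ) : ℚ) ^ (7 - o) * (normaliser9 b : ℚ) * c o p = z := by
    intro p hp
    obtain ⟨z, hz⟩ := hint o p ho (Nat.lt_succ_iff.1 (mem_range.1 hp))
    exact ⟨z, by rw [← hz]; ring⟩
  choose z hz using hterm
  refine ⟨c, hc, ∑ p ∈ (range (bn b 0 + 1)).attach, z p.1 p.2, ?_⟩
  rw [mul_sum, ← sum_attach]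
  push_cast
  exact sum_congr rfl fun p _ => hz p.1 p.2

/-- **`d_{b₀} · N₉(b) · coeff7 b ∈ ℤ`** (the canonical `ζ(7)`-coefficient of `F̃₉(b)`). -/
theorem coeff7_den {b : ℕ → ℤ} (hb : InBox b)
    (hP : ∀ s, s < 8 → bn b (pfst9 s) + bn b (psnd9 s) ≤ bn b 0)
    (hsum : ∑ j ∈ range 9, b (j + 1) ≤ 4 * b 0 + 2) :
    ∃ z : ℤ, ((Nat.lcmUpto (bn b 0) : ℕ) : ℚ) * (normaliser9 b : ℚ) * coeff7 b = z := by
  obtain ⟨c, hc, z, hz⟩ := sum_order_den hb hP hsum 6 (by norm_num)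
  refine ⟨z, ?_⟩
  rw [coeff7_eq hc, show (b 0).toNat = bn b 0 by rfl, ← hz, show (7 : ℕ) - 6 = 1 by rfl, pow_one]

/-- **`d_{b₀}³ · N₉(b) · coeff5 b ∈ ℤ`** (the canonical `ζ(5)`-coefficient). -/
theorem coeff5_den {b : ℕ → ℤ} (hb : InBox b)
    (hP : ∀ s, s < 8 → bn b (pfst9 s) + bn b (psnd9 s) ≤ bn b 0)
    (hsum : ∑ j ∈ range 9, b (j + 1) ≤ 4 * b 0 + 2) :
    ∃ z : ℤ, ((Nat.lcmUpto (bn b 0) : ℕ) : ℚ) ^ 3 * (normaliser9 b : ℚ) * coeff5 b = z := by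
  obtain ⟨c, hc, z, hz⟩ := sum_order_den hb hP hsum 4 (by norm_num)
  refine ⟨z, ?_⟩
  rw [coeff5_eq hc, show (b 0).toNat = bn b 0 by rfl, ← hz, show (7 : ℕ) - 4 = 3 by rfl]

/-- **`d_{b₀}⁵ · N₉(b) · coeff3 b ∈ ℤ`** (the canonical `ζ(3)`-coefficient). -/
theorem coeff3_den {b : ℕ → ℤ} (hb : InBox b)
    (hP : ∀ s, s < 8 → bn b (pfst9 s) + bn b (psnd9 s) ≤ bn b 0)
    (hsum : ∑ j ∈ range 9, b (j + 1) ≤ 4 * b 0 + 2) :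
    ∃ z : ℤ, ((Nat.lcmUpto (bn b 0) : ℕ) : ℚ) ^ 5 * (normaliser9 b : ℚ) * coeff3 b = z := by
  obtain ⟨c, hc, z, hz⟩ := sum_order_den hb hP hsum 2 (by norm_num)
  refine ⟨z, ?_⟩
  rw [coeff3_eq hc, show (b 0).toNat = bn b 0 by rfl, ← hz, show (7 : ℕ) - 2 = 5 by rfl]

/-- **`d_{b₀}⁸ · N₉(b) · coeff0 b ∈ ℤ`** (the canonical constant term, the truncated zeta sums `H_p^{(o+1)}` cleared
by `d_{b₀}^{o+1}`, `BallRivoal.isInt_dpow_mul_harm`). -/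
theorem coeff0_den {b : ℕ → ℤ} (hb : InBox b)
    (hP : ∀ s, s < 8 → bn b (pfst9 s) + bn b (psnd9 s) ≤ bn b 0)
    (hsum : ∑ j ∈ range 9, b (j + 1) ≤ 4 * b 0 + 2) :
    ∃ z : ℤ, ((Nat.lcmUpto (bn b 0) : ℕ) : ℚ) ^ 8 * (normaliser9 b : ℚ) * coeff0 b = z := by
  have hdiv : ∀ k : ℕ, 1 ≤ k → k ≤ bn b 0 → (k : ℤ) ∣ ((Nat.lcmUpto (bn b 0) : ℕ) : ℤ) :=
    fun k h1 h2 => natCast_dvd_lcmUpto h1 h2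
  obtain ⟨c, hc, hint⟩ := exists_int_data9 hb hP hsum (Nat.lcmUpto (bn b 0)) hdiv
  have hterm : ∀ o ∈ range 8, ∀ p ∈ range (bn b 0 + 1), ∃ z : ℤ,
      ((Nat.lcmUpto (bn b 0) : ℕ) : ℚ) ^ 8 * (normaliser9 b : ℚ) * (c o p * harm (o + 1) p) = z := by
    intro o ho p hp
    have ho' := mem_range.1 ho
    have hp' := Nat.lt_succ_iff.1 (mem_range.1 hp)
    obtain ⟨z, hz⟩ := hint o p ho' hp'
    obtain ⟨w, hw⟩ := isInt_dpow_mul_harm (bn b 0) (Nat.lcmUpto (bn b 0)) hdiv (o + 1) p hp'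
    refine ⟨z * w, ?_⟩
    have e : (8 : ℕ) = (7 - o) + (o + 1) := by omega
    rw [e, pow_add]
    push_cast
    rw [← hz, ← hw]
    ring
  choose z hz using hterm
  refine ⟨∑ o ∈ (range 8).attach, ∑ p ∈ (range (bn b 0 + 1)).attach, z o.1 o.2 p.1 p.2, ?_⟩
  rw [coeff0_eq hc, show (b 0).toNat = bn b 0 by rfl, mul_sum, ← sum_attach]
  push_cast
  refine sum_congr rfl fun o _ => ?_
  rw [mul_sum, ← sum_attach]
  exact sum_congr rfl fun p _ => hz o.1 o.2 p.1 p.2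

/-- The pair conditions and the box are decidable per ray; instance: fam-vwp's RAY 1 `β = (3;1⁹)` at `n = 1`
(`b = (3;1,…,1)`): `d₃ · N₉ · coeff7 ∈ ℤ` etc. hold (hypotheses by `decide`). -/
example : ∃ z : ℤ, ((Nat.lcmUpto (bn (base9 ![3, 1, 1, 1, 1, 1, 1, 1, 1, 1]) 0) : ℕ) : ℚ) *
    (normaliser9 (base9 ![3, 1, 1, 1, 1, 1, 1, 1, 1, 1]) : ℚ) * coeff7 (base9 ![3, 1, 1, 1, 1, 1, 1, 1, 1, 1]) = z :=
  coeff7_den ⟨by decide, by decide⟩ (by decide) (by decide)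

end DualSeriesNineDenominators

end Summit.KontsevichZagierPeriods.Zeta5Search
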